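import Mathlib
import HarnessLib
import Literature.Analysis.FluidPDE.SuitableWeak
import Literature.Analysis.FluidPDE.SelfSimilar
import Literature.Analysis.FluidPDE.LocalTypeI
import Literature.Analysis.FluidPDE.NSBoundedMildOseen
import Literature.Analysis.FluidPDE.TypeIRateOseenMildRepresentative
import Literature.Analysis.FluidPDE.LocalTypeIReverseZoom
import Literature.Analysis.FluidPDE.LocalTypeICongr

/-!
# Rate-Type-I singular slab profiles yield non-trivial bounded ancient Oseen-mild fields with the
# same rate (stub `stub_rateToAncient`, line decaying-ancient-bridge of crux RellichScar.ApexLocalisation)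

The ⇒ TRANSFER of the line: from a suitable weak solution `(u, p)` of the unforced Navier–Stokes
system on the backward slab `(−∞, 0) × ℝ³` with a weak gradient `G`, Albritton–Barker's quantity
`𝐈 = 𝐈(ℝ³ × ℝ₋) < ∞`, the Type-I RATE `‖u(t, x)‖ ≤ C/√(−t)` and a (backward) singular point at the
origin, build a NON-trivial member `M` of the class 𝒜(C, B) of the line — continuous on the open slab,
weakly divergence-free slices, the Oseen identity `M(t) = e^{(t−s)Δ}M(s) − B¹_s(M, M)(t)` for all
`s < t < 0`, the bound `‖M‖ ≤ B`, the rate `C`, and suitable-weak data with `𝐈 < ∞`.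

This is the content of the forward direction of Albritton–Barker 2019, Thm. 1.1 ("suitable weak
solution with Type I singular point ⟹ non-trivial mild bounded ancient solution with `𝐈 < ∞`") with
the rate inherited. Since the hypothesis already provides a solution on the WHOLE backward slab with
the GLOBAL rate, no blow-up/compactness procedure is needed (the ENGINE hypothesis of the stub is not
used): the tree theorem `exists_oseenMild_repr_of_typeIBound_lt_top`
(`Literature/Analysis/FluidPDE/TypeIRateOseenMildRepresentative.lean`) provides a representative
`v = u` a.e. which is continuous on the open slab, has weakly divergence-free slices at every negative
time, solves the Oseen integral equation between all pairs of negative times and keeps the rate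
everywhere — its heart being the vanishing of the parasitic drift of KNSS's Lemma 3.1 under the
`A`-part of `𝐈` (`KNSSDriftConstantMorrey.lean`) — and the PAST TIME SHIFT
`M(t, x) = v(t − δ, x)`, `δ > 0`, is then bounded by `B = C/√δ` on the slab, keeps the rate
(`√(−t) ≤ √(δ − t)`), the continuity, the divergence condition and the Oseen identity (time
translation covariance `oseenDuhamel_comp_sub_right`), carries the time-shifted suitable data
(`zoom_isSuitableWeakSolutionOn` with unit scale, `𝐈(M) ≤ 𝐈(u)`; the two slab bookkeeping lemmas are those of the sibling file `…HullClosed`, re-proved privately here to keep this file's import closure inside Literature), and is non-trivial: `v` is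
backward-singular at the origin (a.e.-invariance), hence non-zero at some point `(t₀, y₀)`, `t₀ < 0`,
and `δ = −t₀/2` puts that point at the negative time `t₀/2` of `M`.

## References

* D. Albritton, T. Barker, *On local Type I singularities of the Navier–Stokes equations and
  Liouville theorems*, J. Math. Fluid Mech. 21 (2019) = arXiv:1811.00502, Thm. 1.1, §3.
  [AlbrittonBarker2019]
* G. Koch, N. Nadirashvili, G. Seregin, V. Šverák, Acta Math. 203 (2009) = arXiv:0709.3599, (1.4),
  Lemma 3.1, §4 (i), proof of Thm. 6.1. [KNSS2009, KochNadirashviliSereginSverak2009]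
-/

-- the summit and its single sub-problem share the name (CONVENTIONS §1), as in every Theorems file
set_option linter.dupNamespace false

namespace Summit.NavierStokesRegularity.NavierStokesRegularity.Theorems.RellichScarApexLocalisation

open MeasureTheory Set Function Metric Filter Topology TopologicalSpace
open scoped ENNReal NNReal
open Literature.Analysis Literature.Analysis.FluidPDE

local notation "E³" => EuclideanSpace ℝ (Fin 3)

/-- The backward slab lies in its own pull-back under a past shift / unit-scale zoom (`t₀ ≤ 0`):
`t < 0 ⟹ t₀ + λ² t < 0` (as in the sibling file `…HullClosed`). -/
private theorem slab_le_stPreimage_shift {t₀ : ℝ} (ht₀ : t₀ ≤ 0) {lam : ℝ} (hl0 : 0 < lam) (x₀ : E³) :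
    (slab E³ (Iio 0) isOpen_Iio) ≤ stPreimage (lam ^ 2) lam t₀ x₀ (slab E³ (Iio 0) isOpen_Iio) := by
  intro w hw
  have hw' : w.1 < 0 := by simpa [mem_slab] using hw
  show stAffine (lam ^ 2) lam t₀ x₀ w ∈ (slab E³ (Iio 0) isOpen_Iio : Opens (ℝ × E³))
  rw [mem_slab, stAffine_fst]
  show t₀ + lam ^ 2 * w.1 < 0
  nlinarith [mul_neg_of_pos_of_neg (pow_pos hl0 2) hw']

/-- A parabolic ball inside the backward slab has a non-positive top time (as in the sibling file
`…HullClosed`): otherwise `(z.1 − ε, z.2) ∈ Q(z, r)` has positive time for small `ε > 0`. -/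
private theorem fst_nonpos_of_parabolicCylinder_subset_slab {r : ℝ} (hr : 0 < r) {z : ℝ × E³}
    (h : parabolicCylinder r z ⊆ Iio (0 : ℝ) ×ˢ (univ : Set E³)) : z.1 ≤ 0 := by
  by_contra hz
  push Not at hz
  have hε1 : min (r ^ 2 / 2) (z.1 / 2) ≤ r ^ 2 / 2 := min_le_left _ _
  have hε2 : min (r ^ 2 / 2) (z.1 / 2) ≤ z.1 / 2 := min_le_right _ _
  have hε0 : 0 < min (r ^ 2 / 2) (z.1 / 2) := lt_min (by positivity) (by linarith)
  have hw : (z.1 - min (r ^ 2 / 2) (z.1 / 2), z.2) ∈ parabolicCylinder r z := by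
    rw [mem_parabolicCylinder]
    exact ⟨⟨by dsimp only; nlinarith [sq_nonneg r], by dsimp only; linarith⟩, by simpa using hr⟩
  have : z.1 - min (r ^ 2 / 2) (z.1 / 2) < 0 := (h hw).1
  linarith

/-- **A continuous field with a backward-singular origin is non-zero at some point of negative
time**: otherwise it would vanish on the parabolic ball `Q(0, 1)`, where its `L^∞` norm is `∞`. -/
theorem exists_ne_zero_of_isBackwardSingularPoint {v : ℝ → E³ → E³} (hs : IsBackwardSingularPoint v 0) :
    ∃ t₀ : ℝ, t₀ < 0 ∧ ∃ y₀ : E³, v t₀ y₀ ≠ 0 := by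
  by_contra hcon
  push Not at hcon
  have h1 := hs 1 one_pos
  have h0 : eLpNorm (uncurry v) ∞ (volume.restrict (parabolicCylinder 1 (0 : ℝ × E³))) = 0 := by
    have hae : uncurry v =ᵐ[volume.restrict (parabolicCylinder 1 (0 : ℝ × E³))] 0 := by
      filter_upwards [ae_restrict_mem (isOpen_parabolicCylinder (1 : ℝ) (0 : ℝ × E³)).measurableSet]
        with w hw
      rw [mem_parabolicCylinder] at hw
      exact hcon w.1 (by simpa using hw.1.2) w.2
    rw [eLpNorm_congr_ae hae, eLpNorm_zero]
  rw [h0] at h1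
  exact ENNReal.zero_ne_top h1

/-- **Rate-Type-I singular slab profiles with `𝐈 < ∞` yield non-trivial members of the class
𝒜(C, B)** (stub `stub_rateToAncient` of line decaying-ancient-bridge; Albritton–Barker 2019,
Thm. 1.1, forward direction, with the rate inherited). Granted the slab-compactness ENGINE of the line
(not used), for every `C` and every suitable weak `(u, p, G)` on `(−∞, 0) × ℝ³` with `𝐈 < ∞`, the rate
`‖u(t, x)‖ ≤ C/√(−t)` and a backward-singular origin, there are `B` and `M : ℝ → ℝ³ → ℝ³` with:
`M` continuous on the open slab, weakly divergence-free slices, the Oseen identity for all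
`s < t < 0`, `‖M‖ ≤ B`, the rate `C`, suitable-weak data `(q, H)` on the slab with `𝐈 < ∞`, and
`M(s, y) ≠ 0` for some `s < 0` (module docstring: the continuous Oseen-mild representative of `u`
shifted into the past by `δ = −t₀/2`). -/
theorem stub_rateToAncient :
    (∀ (I : ℝ≥0∞) (v : ℕ → ℝ → E³ → E³) (q : ℕ → ℝ → E³ → ℝ) (G : ℕ → ℝ → E³ → E³ →L[ℝ] E³),
      I < ⊤ →
      (∀ k, IsSuitableWeakSolutionOn (slab E³ (Iio 0) isOpen_Iio) 1 0 (v k) (q k)) →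
      (∀ k, HasWeakSpatialGradientOn (slab E³ (Iio 0) isOpen_Iio) (v k) (G k)) →
      (∀ k, typeIBound (Iio (0 : ℝ) ×ˢ univ) (v k) (q k) (G k) ≤ I) →
      ∃ (u : ℝ → E³ → E³) (p : ℝ → E³ → ℝ) (H : ℝ → E³ → E³ →L[ℝ] E³) (σ : ℕ → ℕ),
        StrictMono σ ∧
        IsSuitableWeakSolutionOn (slab E³ (Iio 0) isOpen_Iio) 1 0 u p ∧
        HasWeakSpatialGradientOn (slab E³ (Iio 0) isOpen_Iio) u H ∧
        typeIBound (Iio (0 : ℝ) ×ˢ univ) u p H ≤ 4 * I ∧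
        (∀ R : ℝ, 0 < R → Tendsto (fun j => eLpNorm (uncurry (v (σ j)) - uncurry u) 3
          (volume.restrict (parabolicCylinder R (0 : ℝ × E³)))) atTop (𝓝 0)) ∧
        ((∀ R : ℝ, 0 < R → limsup (fun j => eLpNorm (uncurry (v (σ j))) ⊤
            (volume.restrict (parabolicCylinder R (0 : ℝ × E³)))) atTop = ⊤) →
          IsBackwardSingularPoint u 0)) →
    ∀ C : ℝ,
      (∃ (u : ℝ → E³ → E³) (p : ℝ → E³ → ℝ) (G : ℝ → E³ → E³ →L[ℝ] E³),
        IsSuitableWeakSolutionOn (slab E³ (Iio 0) isOpen_Iio) 1 0 u p ∧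
        HasWeakSpatialGradientOn (slab E³ (Iio 0) isOpen_Iio) u G ∧
        typeIBound (Iio (0 : ℝ) ×ˢ univ) u p G < ⊤ ∧ HasTypeITimeDecay C u ∧
        IsBackwardSingularPoint u 0) →
      ∃ (B : ℝ) (M : ℝ → E³ → E³),
        (ContinuousOn (uncurry M) (Iio (0 : ℝ) ×ˢ univ) ∧
          (∀ t < 0, IsWeaklyDivFree (M t)) ∧
          (∀ s t : ℝ, s < t → t < 0 → ∀ x : E³,
            M t x = UnboundedOperators.heatExtension (M s) (t - s) x - oseenDuhamel 1 s M M t x) ∧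
          (∀ t < 0, ∀ x : E³, ‖M t x‖ ≤ B) ∧
          HasTypeITimeDecay C M ∧
          (∃ (q : ℝ → E³ → ℝ) (H : ℝ → E³ → E³ →L[ℝ] E³),
            IsSuitableWeakSolutionOn (slab E³ (Iio 0) isOpen_Iio) 1 0 M q ∧
            HasWeakSpatialGradientOn (slab E³ (Iio 0) isOpen_Iio) M H ∧
            typeIBound (Iio (0 : ℝ) ×ˢ univ) M q H < ⊤)) ∧
        (∃ s : ℝ, s < 0 ∧ ∃ y : E³, M s y ≠ 0) := by
  intro _ C hex
  obtain ⟨u, p, G, hsws, hgrad, hI, hC, hsing⟩ := hex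
  -- ## the continuous Oseen-mild representative of `u`
  obtain ⟨v, hae, hvc, hvd, hvm, hvC⟩ := exists_oseenMild_repr_of_typeIBound_lt_top hsws hC hI
  have hC0 : 0 ≤ C := by
    have h := hC (-1) (by norm_num) 0
    rw [neg_neg, Real.sqrt_one, div_one] at h
    exact (norm_nonneg _).trans h
  -- `v` carries the suitable data and the singular origin of `u`
  have hae' : ∀ᵐ w ∂(volume.restrict
      ((slab E³ (Iio 0) isOpen_Iio : Opens (ℝ × E³)) : Set (ℝ × E³))), uncurry u w = uncurry v w := by
    rw [coe_slab]
    exact hae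
  have hsws_v : IsSuitableWeakSolutionOn (slab E³ (Iio 0) isOpen_Iio) 1 0 v p :=
    hsws.congr_ae hae' (ae_of_all _ fun _ => rfl)
  have hgrad_v : HasWeakSpatialGradientOn (slab E³ (Iio 0) isOpen_Iio) v G := hgrad.congr_ae hae'
  have hI_v : typeIBound (Iio (0 : ℝ) ×ˢ univ) v p G < ⊤ := by
    rwa [← typeIBound_congr_ae hae]
  have hsing_v : IsBackwardSingularPoint v 0 :=
    hsing.congr_ae (fun r _ => parabolicCylinder_origin_subset_slab r) hae
  -- ## a point of negative time where `v ≠ 0`, and the shift `δ = −t₀/2`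
  obtain ⟨t₀, ht₀, y₀, hy₀⟩ := exists_ne_zero_of_isBackwardSingularPoint hsing_v
  set δ : ℝ := -t₀ / 2 with hδ
  have hδ0 : 0 < δ := by rw [hδ]; linarith
  have hδle : -δ ≤ 0 := by linarith
  -- ## the past time shift `M(t, x) = v(t − δ, x)`, written as a unit-scale zoom
  set M : ℝ → E³ → E³ := (1 : ℝ) • stPull ((1 : ℝ) ^ 2) 1 (-δ) 0 v with hMdef
  have hMap : ∀ t x, M t x = v (t - δ) x := fun t x => by
    rw [hMdef, smul_stPull_apply, one_smul, one_pow, one_mul, one_smul, zero_add, neg_add_eq_sub]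
  have hMfun : M = fun t x => v (t - δ) x := funext fun t => funext fun x => hMap t x
  refine ⟨C / Real.sqrt δ, M, ⟨?_, ?_, ?_, ?_, ?_, ?_⟩, ?_⟩
  · -- continuity on the open slab
    rw [hMfun]
    refine hvc.comp (f := fun q : ℝ × E³ => (q.1 - δ, q.2))
      ((continuous_fst.sub continuous_const).prodMk continuous_snd).continuousOn ?_
    intro q hq
    exact ⟨show q.1 - δ < 0 by have := mem_Iio.1 hq.1; linarith, mem_univ _⟩
  · -- weakly divergence-free slices
    intro t ht
    rw [hMfun]
    exact hvd (t - δ) (by linarith)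
  · -- the Oseen identity (time translation covariance)
    intro s t hst ht x
    have h1 := hvm (s - δ) (t - δ) (by linarith) (by linarith) x
    rw [show t - δ - (s - δ) = t - s by ring] at h1
    rw [hMfun]
    show v (t - δ) x = UnboundedOperators.heatExtension (v (s - δ)) (t - s) x -
      oseenDuhamel 1 s (fun τ => v (τ - δ)) (fun τ => v (τ - δ)) t x
    rw [oseenDuhamel_comp_sub_right]
    exact h1
  · -- the bound `B = C/√δ`
    intro t ht x
    rw [hMap]
    refine (hvC (t - δ) (by linarith) x).trans
      (div_le_div_of_nonneg_left hC0 (Real.sqrt_pos.2 hδ0) (Real.sqrt_le_sqrt (by linarith)))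
  · -- the rate, with the same constant
    intro t ht x
    rw [hMap]
    refine (hvC (t - δ) (by linarith) x).trans
      (div_le_div_of_nonneg_left hC0 (Real.sqrt_pos.2 (neg_pos.2 ht)) (Real.sqrt_le_sqrt (by linarith)))
  · -- suitable-weak data with `𝐈 < ⊤`: the time-shifted triple
    refine ⟨((1 : ℝ) ^ 2) • stPull ((1 : ℝ) ^ 2) 1 (-δ) 0 p,
      ((1 : ℝ) ^ 2) • stPull ((1 : ℝ) ^ 2) 1 (-δ) 0 G, ?_, ?_, ?_⟩
    · exact (zoom_isSuitableWeakSolutionOn hsws_v one_pos (-δ) 0).of_le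
        (slab_le_stPreimage_shift hδle one_pos 0)
    · exact (zoom_hasWeakSpatialGradientOn hgrad_v one_pos (-δ) 0).mono
        (slab_le_stPreimage_shift hδle one_pos 0)
    · refine lt_of_le_of_lt (typeIBound_le_iff.2 fun r hr z hz => ?_) hI_v
      exact abScaledSum_zoom_le_typeIBound one_pos hδle 0 hr
        (fst_nonpos_of_parabolicCylinder_subset_slab hr hz)
  · -- non-triviality at the negative time `t₀ + δ = t₀/2`
    refine ⟨t₀ + δ, by rw [hδ]; linarith, y₀, ?_⟩
    rw [hMap, add_sub_cancel_right]
    exact hy₀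

end Summit.NavierStokesRegularity.NavierStokesRegularity.Theorems.RellichScarApexLocalisation
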